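import Summits.MatrixMultiplication.MatrixMultiplication.Theorems.FarEdgeDescentQuantumTwin
import Summits.MatrixMultiplication.MatrixMultiplication.Theorems.FarEdgeDescentTwistRigidity
import Summits.MatrixMultiplication.MatrixMultiplication.Theorems.FarEdgeDescentSignTwistCore
import HarnessLib

/-!
# Every twist of the special leaf is a quantum twin of `⟨n,n,2L⟩`

Route `FarEdgeDescent` (cell `decomp-mm`, lens 2 «structural dichotomy (special vs generic)»,
gen 32), Kernel VII part 2; support for the aside `SubLogRate` (stmt-MatrixMultiplication-25371).

Kernel III (`…QuantumTwin.lean`) showed that the transpose twist `𝔖_n(L)` has the same three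
quantum marginals — the scalar matrices `n·1`, `2L·1`, `n·1` in the standard basis — as
`⟨n,n,2L⟩`, hence the same value under EVERY quantum functional `F^θ` (the known universal
spectral points over `ℂ`), although no Kronecker power of `⟨n,n,2L⟩` is a degeneration of the
same power of `𝔖_n(L)` (Kernel II).  This file extends the computation to the whole twist family
of gen 31–32:

* `quantumFunctional_permStar_eq`: for EVERY permutation `φ` of the `X`-format (all `(n²)!` of
  them, special or generic), `F^θ(𝔖_φ) = F^θ(⟨n,n,2L⟩)` for all `θ ≥ 0`;
* `quantumFunctional_weightedStar_eq`, `quantumFunctional_weightedTStar_eq`: the same for the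
  weighted stars `𝔖^w_n(L)`, `𝔖^{wᵀ}_n(L)` of part 1 with UNIMODULAR weights (`|w_b| = 1`; e.g.
  every sign table, in particular `𝔖^♭`, `𝔖^{♭ᵀ}`);
* `permStar_generic_dichotomy`: so for a generic (non-product) `φ` the pair
  `(⟨n,n,2L⟩, 𝔖_φ)` is restriction-INCOMPARABLE at every finite level (Kernel VI) and yet
  indistinguishable by all quantum functionals — the special/generic dichotomy of the twist
  stratum is invisible to the known part of the asymptotic spectrum, in both directions.

The mechanism is one line: a permutation or a unimodular rescaling of the `X`-coordinates of one
leaf changes neither leaf's Gram matrices in slots 1 and 3, and conjugates the slot-2 Gram matrix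
of that leaf by a permutation / diagonal unitary — which fixes a scalar matrix.

References: M. Christandl, P. Vrana, J. Zuiddam, *Universal points in the asymptotic spectrum of
tensors*, J. AMS 36 (2023), Def. 3.16, Thm. 3.19 [ChristandlVranaZuiddam2023]; H. Cohn, C. Umans,
SODA 2013, §3 [CohnUmans2013].
-/

noncomputable section

open scoped BigOperators

set_option linter.dupNamespace false

namespace Summit.MatrixMultiplication.MatrixMultiplication.Theorems.FarEdgeDescentTwistQuantumTwin

open Literature.Computability.AlgebraicComplexity
open Summit.MatrixMultiplication.MatrixMultiplication.Theorems.FarEdgeDescentTwistedStar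
open Summit.MatrixMultiplication.MatrixMultiplication.Theorems.FarEdgeDescentQuantumTwin
open Summit.MatrixMultiplication.MatrixMultiplication.Theorems.FarEdgeDescentTwistRigidity
open Summit.MatrixMultiplication.MatrixMultiplication.Theorems.FarEdgeDescentSignTwist

/-! ## Permutation twists `𝔖_φ` -/

section PermStar
variable (n L : ℕ) (φ : Equiv.Perm (Fin n × Fin n))

/-- `|𝔖_φ⟩⟨𝔖_φ|₁ = n·1` for every permutation `φ`. [folklore] -/
theorem reducedDensity₁_permStar :
    reducedDensity₁ (permStar ℂ n L φ) = (n : ℂ) • 1 := by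
  ext x x'
  rw [reducedDensity₁_apply, Matrix.smul_apply, Matrix.one_apply, smul_eq_mul, mul_ite, mul_one,
    mul_zero]
  simp_rw [Fintype.sum_sum_type, Finset.sum_add_distrib]
  rcases x with a | a <;> rcases x' with a' | a'
  · simp only [permStar_inl_inl, permStar_inl_inr, star_zero, mul_zero, Finset.sum_const_zero,
      add_zero, Sum.inl.injEq]
    exact gram₁_matMulTensor n n L a a'
  · simp
  · simp
  · simp only [permStar_inr_inl, permStar_inr_inr, zero_mul, Finset.sum_const_zero, zero_add,
      Sum.inr.injEq]
    rw [show (∑ b : Fin n × Fin n, ∑ c : Fin n × Fin L, matMulTensor ℂ n n L a (φ b) c *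
        star (matMulTensor ℂ n n L a' (φ b) c)) = ∑ b : Fin n × Fin n, ∑ c : Fin n × Fin L,
        matMulTensor ℂ n n L a b c * star (matMulTensor ℂ n n L a' b c) from
      Fintype.sum_equiv φ _ _ (fun b => rfl)]
    exact gram₁_matMulTensor n n L a a'

/-- `|𝔖_φ⟩⟨𝔖_φ|₂ = 2L·1` for every permutation `φ`. [folklore] -/
theorem reducedDensity₂_permStar :
    reducedDensity₂ (permStar ℂ n L φ) = ((L + L : ℕ) : ℂ) • 1 := by
  ext b b'
  rw [reducedDensity₂_apply, Matrix.smul_apply, Matrix.one_apply, smul_eq_mul, mul_ite, mul_one,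
    mul_zero, Fintype.sum_sum_type]
  simp_rw [Fintype.sum_sum_type]
  simp only [permStar_inl_inl, permStar_inl_inr, permStar_inr_inl, permStar_inr_inr,
    zero_mul, Finset.sum_const_zero, add_zero, zero_add]
  rw [gram₂_matMulTensor, gram₂_matMulTensor]
  by_cases h : b = b'
  · subst h
    simp only [if_true]
    push_cast
    ring
  · rw [if_neg h, if_neg (fun h' => h (φ.injective h')), if_neg h, add_zero]

/-- `|𝔖_φ⟩⟨𝔖_φ|₃ = n·1` for every permutation `φ`. [folklore] -/
theorem reducedDensity₃_permStar :
    reducedDensity₃ (permStar ℂ n L φ) = (n : ℂ) • 1 := by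
  ext x x'
  rw [reducedDensity₃_apply, Matrix.smul_apply, Matrix.one_apply, smul_eq_mul, mul_ite, mul_one,
    mul_zero, Fintype.sum_sum_type]
  rcases x with c | c <;> rcases x' with c' | c'
  · simp only [permStar_inl_inl, permStar_inr_inl, star_zero, mul_zero, Finset.sum_const_zero,
      add_zero, Sum.inl.injEq]
    exact gram₃_matMulTensor n n L c c'
  · simp
  · simp
  · simp only [permStar_inl_inr, permStar_inr_inr, zero_mul, Finset.sum_const_zero, zero_add,
      Sum.inr.injEq]
    rw [show (∑ a : Fin n × Fin L, ∑ b : Fin n × Fin n, matMulTensor ℂ n n L a (φ b) c *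
        star (matMulTensor ℂ n n L a (φ b) c')) = ∑ a : Fin n × Fin L, ∑ b : Fin n × Fin n,
        matMulTensor ℂ n n L a b c * star (matMulTensor ℂ n n L a b c') from
      Finset.sum_congr rfl fun a _ => Fintype.sum_equiv φ _ _ (fun b => rfl)]
    exact gram₃_matMulTensor n n L c c'

/-- `𝔖_φ ≠ 0` for `n, L ≥ 1`. [folklore] -/
theorem permStar_ne_zero' (hn : 1 ≤ n) (hL : 1 ≤ L) : permStar ℂ n L φ ≠ 0 := by
  intro h
  have := congrFun (congrFun (congrFun h (Sum.inl (⟨0, hn⟩, ⟨0, hL⟩))) (⟨0, hn⟩, ⟨0, hn⟩))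
    (Sum.inl (⟨0, hn⟩, ⟨0, hL⟩))
  simp [matMulTensor] at this

/-- **`E_θ(𝔖_φ) = E_θ(⟨n,n,2L⟩)`** for every permutation `φ`, every `θ ≥ 0` (`n, L ≥ 1`).
[cite: ChristandlVranaZuiddam2023, Thm. 3.19.5] -/
theorem logQuantumFunctional_permStar_eq {θ : Fin 3 → ℝ} (hθ : ∀ i, 0 ≤ θ i) (hn : 1 ≤ n)
    (hL : 1 ≤ L) :
    logQuantumFunctional θ (permStar ℂ n L φ) =
      logQuantumFunctional θ (matMulTensor ℂ n n (L + L)) := by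
  rw [logQuantumFunctional_eq_of_scalar_marginals hθ (permStar_ne_zero' n L φ hn hL)
    (reducedDensity₁_permStar n L φ) (reducedDensity₂_permStar n L φ)
    (reducedDensity₃_permStar n L φ),
    logQuantumFunctional_matMulTensor n n (L + L) hθ hn hn (le_trans hL (Nat.le_add_right L L))]
  simp only [Fintype.card_sum, Fintype.card_prod, Fintype.card_fin]
  push_cast
  ring

/-- **Quantum invisibility of every permutation twist.** `F^θ(𝔖_φ) = F^θ(⟨n,n,2L⟩)` for every
permutation `φ` of the `X`-format and every `θ ≥ 0` (`n, L ≥ 1`). [cite: ChristandlVranaZuiddam2023, Def. 3.16] -/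
theorem quantumFunctional_permStar_eq (θ : Fin 3 → ℝ) (hθ : ∀ i, 0 ≤ θ i) (hn : 1 ≤ n)
    (hL : 1 ≤ L) :
    quantumFunctional θ (permStar ℂ n L φ) = quantumFunctional θ (matMulTensor ℂ n n (L + L)) := by
  rw [quantumFunctional_of_ne_zero θ (permStar_ne_zero' n L φ hn hL),
    quantumFunctional_of_ne_zero θ
      (matMulTensor_ne_zero n n (L + L) hn hn (le_trans hL (Nat.le_add_right L L))),
    logQuantumFunctional_permStar_eq n L φ hθ hn hL]

/-- **The special/generic dichotomy is quantum-invisible.** For a generic (non-product) `φ`,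
`n, L ≥ 1`, `N ≥ 1`, `θ ≥ 0`: `𝔖_φ^{⊠N}` and `⟨n,n,2L⟩^{⊠N}` are restriction-incomparable
(Kernel VI), yet every quantum functional takes the same value on `𝔖_φ` and `⟨n,n,2L⟩`.
[cite: ChristandlVranaZuiddam2023, Def. 3.16] -/
theorem permStar_generic_dichotomy (N : ℕ) (hφ : ¬ IsProdPerm φ) (hn : 1 ≤ n) (hL : 1 ≤ L)
    (hN : 1 ≤ N) (θ : Fin 3 → ℝ) (hθ : ∀ i, 0 ≤ θ i) :
    ¬ TensorRestrictsTo (kroneckerPow (permStar ℂ n L φ) N)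
        (kroneckerPow (matMulTensor ℂ n n (L + L)) N) ∧
      ¬ TensorRestrictsTo (kroneckerPow (matMulTensor ℂ n n (L + L)) N)
        (kroneckerPow (permStar ℂ n L φ) N) ∧
      quantumFunctional θ (permStar ℂ n L φ) = quantumFunctional θ (matMulTensor ℂ n n (L + L)) :=
  ⟨(permStar_pow_restriction_incomparable (K := ℂ) hφ hL hN).1,
    (permStar_pow_restriction_incomparable (K := ℂ) hφ hL hN).2,
    quantumFunctional_permStar_eq n L φ θ hθ hn hL⟩

end PermStar

/-! ## Weighted stars `𝔖^w_n(L)`, `𝔖^{wᵀ}_n(L)` with unimodular weights -/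

section Weighted
variable (n L : ℕ) (w : Fin n × Fin n → ℂ)

/-- Unimodular weights cancel inside a Gram entry: `w_b x · conj(w_b y) = x · conj y`. [folklore] -/
theorem weight_mul_star (hw : ∀ b, star (w b) * w b = 1) (b : Fin n × Fin n) (x y : ℂ) :
    w b * x * star (w b * y) = x * star y := by
  rw [star_mul', show w b * x * (star (w b) * star y) = (star (w b) * w b) * (x * star y) by ring,
    hw, one_mul]

/-- `|𝔖^w⟩⟨𝔖^w|₁ = n·1` for unimodular `w`. [folklore] -/
theorem reducedDensity₁_weightedStar (hw : ∀ b, star (w b) * w b = 1) :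
    reducedDensity₁ (weightedStar ℂ n L w) = (n : ℂ) • 1 := by
  ext x x'
  rw [reducedDensity₁_apply, Matrix.smul_apply, Matrix.one_apply, smul_eq_mul, mul_ite, mul_one,
    mul_zero]
  simp_rw [Fintype.sum_sum_type, Finset.sum_add_distrib]
  rcases x with a | a <;> rcases x' with a' | a'
  · simp only [weightedStar_inl_inl, weightedStar_inl_inr, star_zero, mul_zero,
      Finset.sum_const_zero, add_zero, Sum.inl.injEq]
    exact gram₁_matMulTensor n n L a a'
  · simp
  · simp
  · simp only [weightedStar_inr_inl, weightedStar_inr_inr, zero_mul, Finset.sum_const_zero,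
      zero_add, Sum.inr.injEq]
    simp_rw [weight_mul_star n w hw]
    exact gram₁_matMulTensor n n L a a'

/-- `|𝔖^w⟩⟨𝔖^w|₂ = 2L·1` for unimodular `w`. [folklore] -/
theorem reducedDensity₂_weightedStar (hw : ∀ b, star (w b) * w b = 1) :
    reducedDensity₂ (weightedStar ℂ n L w) = ((L + L : ℕ) : ℂ) • 1 := by
  ext b b'
  rw [reducedDensity₂_apply, Matrix.smul_apply, Matrix.one_apply, smul_eq_mul, mul_ite, mul_one,
    mul_zero, Fintype.sum_sum_type]
  simp_rw [Fintype.sum_sum_type]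
  simp only [weightedStar_inl_inl, weightedStar_inl_inr, weightedStar_inr_inl, weightedStar_inr_inr,
    zero_mul, Finset.sum_const_zero, add_zero, zero_add]
  have e : ∀ (a : Fin n × Fin L) (c : Fin n × Fin L),
      w b * matMulTensor ℂ n n L a b c * star (w b' * matMulTensor ℂ n n L a b' c) =
        (w b * star (w b')) * (matMulTensor ℂ n n L a b c * star (matMulTensor ℂ n n L a b' c)) := by
    intro a c; rw [star_mul']; ring
  simp_rw [e, ← Finset.mul_sum]
  rw [gram₂_matMulTensor]
  by_cases h : b = b'
  · subst h
    simp only [if_true]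
    rw [mul_comm (w b) (star (w b)), hw]
    push_cast
    ring
  · rw [if_neg h, if_neg h, mul_zero, add_zero]

/-- `|𝔖^w⟩⟨𝔖^w|₃ = n·1` for unimodular `w`. [folklore] -/
theorem reducedDensity₃_weightedStar (hw : ∀ b, star (w b) * w b = 1) :
    reducedDensity₃ (weightedStar ℂ n L w) = (n : ℂ) • 1 := by
  ext x x'
  rw [reducedDensity₃_apply, Matrix.smul_apply, Matrix.one_apply, smul_eq_mul, mul_ite, mul_one,
    mul_zero, Fintype.sum_sum_type]
  rcases x with c | c <;> rcases x' with c' | c'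
  · simp only [weightedStar_inl_inl, weightedStar_inr_inl, star_zero, mul_zero,
      Finset.sum_const_zero, add_zero, Sum.inl.injEq]
    exact gram₃_matMulTensor n n L c c'
  · simp
  · simp
  · simp only [weightedStar_inl_inr, weightedStar_inr_inr, zero_mul, Finset.sum_const_zero,
      zero_add, Sum.inr.injEq]
    simp_rw [weight_mul_star n w hw]
    exact gram₃_matMulTensor n n L c c'

/-- `|𝔖^{wᵀ}⟩⟨𝔖^{wᵀ}|₁ = n·1` for unimodular `w`. [folklore] -/
theorem reducedDensity₁_weightedTStar (hw : ∀ b, star (w b) * w b = 1) :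
    reducedDensity₁ (weightedTStar ℂ n L w) = (n : ℂ) • 1 := by
  ext x x'
  rw [reducedDensity₁_apply, Matrix.smul_apply, Matrix.one_apply, smul_eq_mul, mul_ite, mul_one,
    mul_zero]
  simp_rw [Fintype.sum_sum_type, Finset.sum_add_distrib]
  rcases x with a | a <;> rcases x' with a' | a'
  · simp only [weightedTStar_inl_inl, weightedTStar_inl_inr, star_zero, mul_zero,
      Finset.sum_const_zero, add_zero, Sum.inl.injEq]
    exact gram₁_matMulTensor n n L a a'
  · simp
  · simp
  · simp only [weightedTStar_inr_inl, weightedTStar_inr_inr, zero_mul, Finset.sum_const_zero,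
      zero_add, Sum.inr.injEq]
    simp_rw [weight_mul_star n w hw]
    rw [show (∑ b : Fin n × Fin n, ∑ c : Fin n × Fin L, matMulTensor ℂ n n L a b.swap c *
        star (matMulTensor ℂ n n L a' b.swap c)) = ∑ b : Fin n × Fin n, ∑ c : Fin n × Fin L,
        matMulTensor ℂ n n L a b c * star (matMulTensor ℂ n n L a' b c) from
      Fintype.sum_equiv (Equiv.prodComm _ _) _ _ (fun b => rfl)]
    exact gram₁_matMulTensor n n L a a'

/-- `|𝔖^{wᵀ}⟩⟨𝔖^{wᵀ}|₂ = 2L·1` for unimodular `w`. [folklore] -/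
theorem reducedDensity₂_weightedTStar (hw : ∀ b, star (w b) * w b = 1) :
    reducedDensity₂ (weightedTStar ℂ n L w) = ((L + L : ℕ) : ℂ) • 1 := by
  ext b b'
  rw [reducedDensity₂_apply, Matrix.smul_apply, Matrix.one_apply, smul_eq_mul, mul_ite, mul_one,
    mul_zero, Fintype.sum_sum_type]
  simp_rw [Fintype.sum_sum_type]
  simp only [weightedTStar_inl_inl, weightedTStar_inl_inr, weightedTStar_inr_inl,
    weightedTStar_inr_inr, zero_mul, Finset.sum_const_zero, add_zero, zero_add]
  have e : ∀ (a : Fin n × Fin L) (c : Fin n × Fin L),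
      w b * matMulTensor ℂ n n L a b.swap c * star (w b' * matMulTensor ℂ n n L a b'.swap c) =
        (w b * star (w b')) *
          (matMulTensor ℂ n n L a b.swap c * star (matMulTensor ℂ n n L a b'.swap c)) := by
    intro a c; rw [star_mul']; ring
  simp_rw [e, ← Finset.mul_sum]
  rw [gram₂_matMulTensor, gram₂_matMulTensor]
  by_cases h : b = b'
  · subst h
    simp only [if_true]
    rw [mul_comm (w b) (star (w b)), hw]
    push_cast
    ring
  · rw [if_neg h, if_neg (fun h' => h (Prod.swap_inj.1 h')), if_neg h, mul_zero, add_zero]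

/-- `|𝔖^{wᵀ}⟩⟨𝔖^{wᵀ}|₃ = n·1` for unimodular `w`. [folklore] -/
theorem reducedDensity₃_weightedTStar (hw : ∀ b, star (w b) * w b = 1) :
    reducedDensity₃ (weightedTStar ℂ n L w) = (n : ℂ) • 1 := by
  ext x x'
  rw [reducedDensity₃_apply, Matrix.smul_apply, Matrix.one_apply, smul_eq_mul, mul_ite, mul_one,
    mul_zero, Fintype.sum_sum_type]
  rcases x with c | c <;> rcases x' with c' | c'
  · simp only [weightedTStar_inl_inl, weightedTStar_inr_inl, star_zero, mul_zero,
      Finset.sum_const_zero, add_zero, Sum.inl.injEq]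
    exact gram₃_matMulTensor n n L c c'
  · simp
  · simp
  · simp only [weightedTStar_inl_inr, weightedTStar_inr_inr, zero_mul, Finset.sum_const_zero,
      zero_add, Sum.inr.injEq]
    simp_rw [weight_mul_star n w hw]
    rw [show (∑ a : Fin n × Fin L, ∑ b : Fin n × Fin n, matMulTensor ℂ n n L a b.swap c *
        star (matMulTensor ℂ n n L a b.swap c')) = ∑ a : Fin n × Fin L, ∑ b : Fin n × Fin n,
        matMulTensor ℂ n n L a b c * star (matMulTensor ℂ n n L a b c') from
      Finset.sum_congr rfl fun a _ => Fintype.sum_equiv (Equiv.prodComm _ _) _ _ (fun b => rfl)]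
    exact gram₃_matMulTensor n n L c c'

/-- `𝔖^w_n(L) ≠ 0` for `n, L ≥ 1` (the coherent leaf is nonzero). [folklore] -/
theorem weightedStar_ne_zero (hn : 1 ≤ n) (hL : 1 ≤ L) : weightedStar ℂ n L w ≠ 0 := by
  intro h
  have := congrFun (congrFun (congrFun h (Sum.inl (⟨0, hn⟩, ⟨0, hL⟩))) (⟨0, hn⟩, ⟨0, hn⟩))
    (Sum.inl (⟨0, hn⟩, ⟨0, hL⟩))
  simp [matMulTensor] at this

/-- `𝔖^{wᵀ}_n(L) ≠ 0` for `n, L ≥ 1`. [folklore] -/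
theorem weightedTStar_ne_zero (hn : 1 ≤ n) (hL : 1 ≤ L) : weightedTStar ℂ n L w ≠ 0 := by
  intro h
  have := congrFun (congrFun (congrFun h (Sum.inl (⟨0, hn⟩, ⟨0, hL⟩))) (⟨0, hn⟩, ⟨0, hn⟩))
    (Sum.inl (⟨0, hn⟩, ⟨0, hL⟩))
  simp [matMulTensor] at this

/-- **Quantum invisibility of unimodular weight twists.** `F^θ(𝔖^w_n(L)) = F^θ(⟨n,n,2L⟩)` for
`|w| ≡ 1`, every `θ ≥ 0` (`n, L ≥ 1`). [cite: ChristandlVranaZuiddam2023, Def. 3.16, Thm. 3.19.5] -/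
theorem quantumFunctional_weightedStar_eq (hw : ∀ b, star (w b) * w b = 1) (θ : Fin 3 → ℝ)
    (hθ : ∀ i, 0 ≤ θ i) (hn : 1 ≤ n) (hL : 1 ≤ L) :
    quantumFunctional θ (weightedStar ℂ n L w) =
      quantumFunctional θ (matMulTensor ℂ n n (L + L)) := by
  have hp : 1 ≤ L + L := le_trans hL (Nat.le_add_right L L)
  rw [quantumFunctional_of_ne_zero θ (weightedStar_ne_zero n L w hn hL),
    quantumFunctional_of_ne_zero θ (matMulTensor_ne_zero n n (L + L) hn hn hp),
    logQuantumFunctional_eq_of_scalar_marginals hθ (weightedStar_ne_zero n L w hn hL)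
      (reducedDensity₁_weightedStar n L w hw) (reducedDensity₂_weightedStar n L w hw)
      (reducedDensity₃_weightedStar n L w hw),
    logQuantumFunctional_matMulTensor n n (L + L) hθ hn hn hp]
  simp only [Fintype.card_sum, Fintype.card_prod, Fintype.card_fin]
  push_cast
  ring_nf

/-- **Quantum invisibility of unimodular transposed weight twists.**
`F^θ(𝔖^{wᵀ}_n(L)) = F^θ(⟨n,n,2L⟩)` for `|w| ≡ 1`, every `θ ≥ 0` (`n, L ≥ 1`).
[cite: ChristandlVranaZuiddam2023, Def. 3.16, Thm. 3.19.5] -/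
theorem quantumFunctional_weightedTStar_eq (hw : ∀ b, star (w b) * w b = 1) (θ : Fin 3 → ℝ)
    (hθ : ∀ i, 0 ≤ θ i) (hn : 1 ≤ n) (hL : 1 ≤ L) :
    quantumFunctional θ (weightedTStar ℂ n L w) =
      quantumFunctional θ (matMulTensor ℂ n n (L + L)) := by
  have hp : 1 ≤ L + L := le_trans hL (Nat.le_add_right L L)
  rw [quantumFunctional_of_ne_zero θ (weightedTStar_ne_zero n L w hn hL),
    quantumFunctional_of_ne_zero θ (matMulTensor_ne_zero n n (L + L) hn hn hp),
    logQuantumFunctional_eq_of_scalar_marginals hθ (weightedTStar_ne_zero n L w hn hL)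
      (reducedDensity₁_weightedTStar n L w hw) (reducedDensity₂_weightedTStar n L w hw)
      (reducedDensity₃_weightedTStar n L w hw),
    logQuantumFunctional_matMulTensor n n (L + L) hθ hn hn hp]
  simp only [Fintype.card_sum, Fintype.card_prod, Fintype.card_fin]
  push_cast
  ring_nf

end Weighted

/-! ## The sign stars: the three generic classes at `n = 2` are mutual quantum twins -/

section Sign

/-- The sign table is unimodular. [folklore] -/
theorem sgnWeight_unimodular (b : Fin 2 × Fin 2) : star (sgnWeight ℂ b) * sgnWeight ℂ b = 1 := by
  unfold sgnWeight; split_ifs <;> simp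

/-- **`F^θ(𝔖^♭) = F^θ(𝔖^{♭ᵀ}) = F^θ(𝔖_2(1)) = F^θ(⟨2,2,2⟩)`** for every `θ ≥ 0`, while no
Kronecker power of `𝔖^♭` or of `𝔖^{♭ᵀ}` is a degeneration of the same power of `𝔖_2(1)`
(part 1): the three generic twist classes of `⟨2,2,2⟩` and `⟨2,2,2⟩` itself are pairwise quantum
twins. [cite: ChristandlVranaZuiddam2023, Def. 3.16] -/
theorem sign_classes_quantum_twins (N : ℕ) (hN : 1 ≤ N) (θ : Fin 3 → ℝ) (hθ : ∀ i, 0 ≤ θ i) :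
    quantumFunctional θ (signStar ℂ) = quantumFunctional θ (matMulTensor ℂ 2 2 (1 + 1)) ∧
      quantumFunctional θ (signTStar ℂ) = quantumFunctional θ (matMulTensor ℂ 2 2 (1 + 1)) ∧
      quantumFunctional θ (twistedStar ℂ 2 1) = quantumFunctional θ (matMulTensor ℂ 2 2 (1 + 1)) ∧
      ¬ AlgDegeneratesTo (kroneckerPow (twistedStar ℂ 2 1) N) (kroneckerPow (signStar ℂ) N) ∧
      ¬ AlgDegeneratesTo (kroneckerPow (twistedStar ℂ 2 1) N) (kroneckerPow (signTStar ℂ) N) :=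
  ⟨quantumFunctional_weightedStar_eq 2 1 _ sgnWeight_unimodular θ hθ (by norm_num) le_rfl,
    quantumFunctional_weightedTStar_eq 2 1 _ sgnWeight_unimodular θ hθ (by norm_num) le_rfl,
    quantumFunctional_twistedStar_eq 2 1 θ hθ (by norm_num) le_rfl,
    twistedStar_pow_not_algDegeneratesTo_signStar N hN,
    twistedStar_pow_not_algDegeneratesTo_signTStar (by norm_num) N hN⟩

end Sign

end Summit.MatrixMultiplication.MatrixMultiplication.Theorems.FarEdgeDescentTwistQuantumTwin

end
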